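import Summits.CriticalPhenomena.PercolationContinuityZ3.Theorems.PercNearOneGluingNoHeavyLowerTailSahiThreeCopyCellMirror

/-!
# `NoHeavyLowerTail` (crux stmt-CriticalPhenomena-4575), Sahi programme: **CELL CERTIFICATES II — generators, sparse vectors, verified
# array accumulation**

Support file (Sahi cell, seat `prim-sahi-p1`, generation 65; `--supports stmt-CriticalPhenomena-4575`); part II of the verified cell-certificate
checker (part I `…CellMirror`, part III `…CellCheck`).  Definitions + lemmas only, no evaluation; no `sorry`, standard axioms.

CONTENT.  §3 GENERATORS `(kind, a, b) : Gen`: kind `0` = point evaluation `e_a`, kind `1` = cover difference `e_b − e_a`, otherwise the score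
difference `ℓ_a − ℓ_b` (scores `ℓZ : ℕ → Pt k → ℤ` indexed by block number); their level functions `genFunZ`, sparse vectors `genSparse`
(lists of `(code, coefficient)`), `evalSparse`, admissibility `genOK k M P` (codes `< 2^k`, covers monotone via `a ||| b = b`, scores anchored at
the cell block `P` against a block `< M`), ★ `evalSparse_genSparse` (the sparse vector represents the level function) and ★ `genFun_dot_nonneg`
(an admissible generator is nonnegative on the nonnegative monotone functions of its cell).  §4 ACCUMULATION: `addEntries`, `addLam` (1-D),
`addEntry2`/`addRow`/`addTerm`/`accGH` (2-D, `Σ x·u ⊗ v` over sparse rank-one terms) with their exact semantics `getElem?_addEntries`,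
`getElem?_addLam`, ★ `entry2_accGH` (`entry (i,j) = ghEval = Σ x·u(i)·v(j)`), proved from `Array.getElem?_modify` alone. [this work]
-/

namespace Summit.CriticalPhenomena.PercolationContinuityZ3.Theorems.SahiThreeCopy

open Finset Function Literature.Combinatorics.Sahi2008
open scoped BigOperators

variable {k : ℕ}

/-! ### §3 Generators, sparse vectors and their semantics -/

/-- A GENERATOR `(kind, a, b)`: kind `0` = point evaluation `e_a`; kind `1` = cover difference `e_b − e_a`; otherwise the score
difference `ℓ_a − ℓ_b` (`a, b` block numbers). [this work] -/
abbrev Gen := ℕ × ℕ × ℕ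

/-- The level function of a generator (integer valued; scores `ℓZ` indexed by block number). [this work] -/
def genFunZ (k : ℕ) (ℓZ : ℕ → Pt k → ℤ) (g : Gen) (e : Pt k) : ℤ :=
  if g.1 = 0 then (if e = ptOfCode k g.2.1 then 1 else 0)
  else if g.1 = 1 then (if e = ptOfCode k g.2.2 then 1 else 0) - (if e = ptOfCode k g.2.1 then 1 else 0)
  else ℓZ g.2.1 e - ℓZ g.2.2 e

/-- The SPARSE VECTOR (list of `(point code, coefficient)`) of a generator. [this work] -/
def genSparse (k : ℕ) (ℓZ : ℕ → Pt k → ℤ) (g : Gen) : List (ℕ × ℤ) :=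
  if g.1 = 0 then [(g.2.1, 1)]
  else if g.1 = 1 then [(g.2.2, 1), (g.2.1, -1)]
  else (List.range (2 ^ k)).filterMap fun p =>
    if ℓZ g.2.1 (ptOfCode k p) - ℓZ g.2.2 (ptOfCode k p) = 0 then none
    else some (p, ℓZ g.2.1 (ptOfCode k p) - ℓZ g.2.2 (ptOfCode k p))

/-- Evaluation of a sparse vector at a code (sum of the coefficients listed at that code). [this work] -/
def evalSparse : List (ℕ × ℤ) → ℕ → ℤ
  | [], _ => 0
  | pa :: l, n => (if pa.1 = n then pa.2 else 0) + evalSparse l n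

/-- `evalSparse` on `cons` (definitional unfolding). [this work] -/
@[simp] theorem evalSparse_cons (pa : ℕ × ℤ) (l : List (ℕ × ℤ)) (n : ℕ) :
    evalSparse (pa :: l) n = (if pa.1 = n then pa.2 else 0) + evalSparse l n := rfl

/-- `evalSparse [] = 0`. [this work] -/
@[simp] theorem evalSparse_nil (n : ℕ) : evalSparse [] n = 0 := rfl

/-- A sparse vector with nonnegative coefficients evaluates nonnegatively. [this work] -/
theorem evalSparse_nonneg : ∀ (l : List (ℕ × ℤ)), (∀ pa ∈ l, 0 ≤ pa.2) → ∀ n, 0 ≤ evalSparse l n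
  | [], _, _ => le_rfl
  | pa :: l, h, n => by
    rw [evalSparse_cons]
    refine add_nonneg ?_ (evalSparse_nonneg l (fun q hq => h q (by simp [hq])) n)
    have := h pa (by simp)
    split_ifs <;> omega

/-- `evalSparse` of a `filterMap` keeping the nonzero values of `d` along a duplicate-free list of codes. [this work] -/
theorem evalSparse_filterMap (d : ℕ → ℤ) : ∀ (ps : List ℕ), ps.Nodup → ∀ n,
    evalSparse (ps.filterMap fun p => if d p = 0 then none else some (p, d p)) n = if n ∈ ps then d n else 0
  | [], _, n => by simp
  | p :: ps, hnd, n => by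
    rw [List.nodup_cons] at hnd
    have ih := evalSparse_filterMap d ps hnd.2 n
    rw [List.filterMap_cons]
    by_cases hd : d p = 0
    · simp only [hd, if_true, ih]
      by_cases hnp : n = p
      · subst hnp; simp [hd]
      · simp [hnp]
    · simp only [hd, if_false, evalSparse_cons, ih]
      by_cases hnp : n = p
      · subst hnp; simp [hnd.1]
      · simp [hnp, Ne.symm hnp]

/-- ADMISSIBILITY of a generator on a side whose cell block is `P` (`M` blocks, codes `< 2^k`, covers monotone, scores anchored
at `P` against a block `< M`). [this work] -/
def genOK (k M P : ℕ) (g : Gen) : Bool :=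
  if g.1 = 0 then decide (g.2.1 < 2 ^ k)
  else if g.1 = 1 then decide (g.2.1 < 2 ^ k) && decide (g.2.2 < 2 ^ k) && (g.2.1 ||| g.2.2 == g.2.2)
  else decide (g.2.1 = P) && decide (g.2.2 < M)

/-- ★ The sparse vector of an admissible generator evaluates, at the code of a level, to the generator's level function. [this work] -/
theorem evalSparse_genSparse (ℓZ : ℕ → Pt k → ℤ) {M P : ℕ} {g : Gen} (hg : genOK k M P g = true) (e : Pt k) :
    evalSparse (genSparse k ℓZ g) (codeOf k e) = genFunZ k ℓZ g e := by
  unfold genOK at hg; unfold genSparse genFunZ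
  by_cases h0 : g.1 = 0
  · simp only [h0, if_true, decide_eq_true_eq] at hg ⊢
    simp only [evalSparse_cons, evalSparse_nil, add_zero]
    have hiff : (g.2.1 = codeOf k e) ↔ (e = ptOfCode k g.2.1) := by rw [eq_comm]; exact codeOf_eq_iff k e hg
    exact if_congr hiff rfl rfl
  · by_cases h1 : g.1 = 1
    · simp only [h1, if_true, one_ne_zero, if_false, Bool.and_eq_true, decide_eq_true_eq, beq_iff_eq] at hg ⊢
      simp only [evalSparse_cons, evalSparse_nil, add_zero]
      have hiff1 : (g.2.1 = codeOf k e) ↔ (e = ptOfCode k g.2.1) := by rw [eq_comm]; exact codeOf_eq_iff k e hg.1.1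
      have hiff2 : (g.2.2 = codeOf k e) ↔ (e = ptOfCode k g.2.2) := by rw [eq_comm]; exact codeOf_eq_iff k e hg.1.2
      rw [if_congr hiff1 rfl rfl, if_congr hiff2 rfl rfl]
      split_ifs <;> simp
    · simp only [h0, h1, if_false]
      rw [evalSparse_filterMap _ _ List.nodup_range]
      simp only [List.mem_range, codeOf_lt, if_true, ptOfCode_codeOf]

/-- ★ An admissible generator is NONNEGATIVE on the nonnegative monotone functions of its side's cell. [this work] -/
theorem genFun_dot_nonneg (ℓZ : ℕ → Pt k → ℤ) {M P : ℕ} {g : Gen} (hg : genOK k M P g = true) {φ : Pt k → ℝ}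
    (hφ : ∀ e, 0 ≤ φ e) (hφm : Monotone φ) (hcell : ∀ j, j < M → ∑ e, (ℓZ j e : ℝ) * φ e ≤ ∑ e, (ℓZ P e : ℝ) * φ e) :
    0 ≤ ∑ e, (genFunZ k ℓZ g e : ℝ) * φ e := by
  unfold genOK at hg; unfold genFunZ
  by_cases h0 : g.1 = 0
  · simp only [h0, if_true] at hg ⊢
    simp only [Int.cast_ite, Int.cast_one, Int.cast_zero, ite_mul, one_mul, zero_mul, Finset.sum_ite_eq', mem_univ, if_true]
    exact hφ _
  · by_cases h1 : g.1 = 1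
    · simp only [h1, if_true, one_ne_zero, if_false, Bool.and_eq_true, decide_eq_true_eq, beq_iff_eq] at hg ⊢
      simp only [Int.cast_sub, Int.cast_ite, Int.cast_one, Int.cast_zero, sub_mul, ite_mul, one_mul, zero_mul, sum_sub_distrib,
        Finset.sum_ite_eq', mem_univ, if_true, sub_nonneg]
      exact hφm (ptOfCode_le_of_lor hg.2)
    · simp only [h0, h1, if_false, Bool.and_eq_true, decide_eq_true_eq] at hg ⊢
      simp only [Int.cast_sub, sub_mul, sum_sub_distrib, sub_nonneg]
      rw [hg.1]
      exact hcell _ hg.2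

/-! ### §4 Accumulation into arrays (verified) -/

/-- Add the entries of a sparse vector into a 1-D array (out-of-range codes are ignored). [this work] -/
def addEntries : Array ℤ → List (ℕ × ℤ) → Array ℤ
  | A, [] => A
  | A, pa :: l => addEntries (A.modify pa.1 (· + pa.2)) l

/-- ★ Semantics of `addEntries`: every in-range cell gains the sparse vector's value there. [this work] -/
theorem getElem?_addEntries : ∀ (A : Array ℤ) (l : List (ℕ × ℤ)) (n : ℕ),
    (addEntries A l)[n]? = A[n]?.map (· + evalSparse l n)
  | A, [], n => by rw [addEntries]; cases A[n]? <;> simp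
  | A, pa :: l, n => by
    rw [addEntries, getElem?_addEntries, Array.getElem?_modify, evalSparse_cons]
    cases A[n]? <;> split_ifs <;> simp [add_assoc]

/-- Add the transfers `x·(e_q − e_p)` of a list `(p, q, x)` into a 1-D array. [this work] -/
def addLam : Array ℤ → List (ℕ × ℕ × ℤ) → Array ℤ
  | A, [] => A
  | A, t :: l => addLam ((A.modify t.2.1 (· + t.2.2)).modify t.1 (· - t.2.2)) l

/-- The value at code `n` of the transfers of a list. [this work] -/
def lamEval : List (ℕ × ℕ × ℤ) → ℕ → ℤ
  | [], _ => 0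
  | t :: l, n => t.2.2 * ((if t.2.1 = n then 1 else 0) - (if t.1 = n then 1 else 0)) + lamEval l n

/-- ★ Semantics of `addLam`. [this work] -/
theorem getElem?_addLam : ∀ (A : Array ℤ) (l : List (ℕ × ℕ × ℤ)) (n : ℕ), (addLam A l)[n]? = A[n]?.map (· + lamEval l n)
  | A, [], n => by rw [addLam]; cases A[n]? <;> simp [lamEval]
  | A, t :: l, n => by
    rw [addLam, getElem?_addLam, Array.getElem?_modify, Array.getElem?_modify, lamEval]
    cases A[n]? <;> split_ifs <;> simp <;> ring

/-- Entry `(i, j)` of a 2-D array (if in range). [this work] -/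
def entry2 (A : Array (Array ℤ)) (i j : ℕ) : Option ℤ := A[i]?.bind fun row => row[j]?

/-- Add `c` to entry `(p, q)`. [this work] -/
def addEntry2 (A : Array (Array ℤ)) (p q : ℕ) (c : ℤ) : Array (Array ℤ) := A.modify p fun row => row.modify q (· + c)

/-- Semantics of `addEntry2`. [this work] -/
theorem entry2_addEntry2 (A : Array (Array ℤ)) (p q : ℕ) (c : ℤ) (i j : ℕ) :
    entry2 (addEntry2 A p q c) i j = (entry2 A i j).map fun v => if p = i ∧ q = j then v + c else v := by
  unfold entry2 addEntry2
  rw [Array.getElem?_modify]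
  cases hA : A[i]? with
  | none => split_ifs <;> simp
  | some row =>
    by_cases hp : p = i
    · simp only [hp, if_true, Option.map_some, Option.bind_some, Array.getElem?_modify, true_and]
      cases row[j]? <;> split_ifs <;> simp_all
    · simp only [hp, if_false, Option.bind_some, false_and]
      cases row[j]? <;> simp

/-- Add `xa · v` to row `p` (`v` a sparse vector). [this work] -/
def addRow : Array (Array ℤ) → ℕ → ℤ → List (ℕ × ℤ) → Array (Array ℤ)
  | A, _, _, [] => A
  | A, p, xa, qb :: vS => addRow (addEntry2 A p qb.1 (xa * qb.2)) p xa vS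

/-- Semantics of `addRow`. [this work] -/
theorem entry2_addRow : ∀ (A : Array (Array ℤ)) (p : ℕ) (xa : ℤ) (vS : List (ℕ × ℤ)) (i j : ℕ),
    entry2 (addRow A p xa vS) i j = (entry2 A i j).map (· + if p = i then xa * evalSparse vS j else 0)
  | A, p, xa, [], i, j => by rw [addRow]; cases entry2 A i j <;> simp
  | A, p, xa, qb :: vS, i, j => by
    rw [addRow, entry2_addRow, entry2_addEntry2, evalSparse_cons]
    cases entry2 A i j <;> simp only [Option.map_none, Option.map_some]
    split_ifs <;> simp_all; ring

/-- Add `x · u ⊗ v` (sparse `u`, `v`). [this work] -/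
def addTerm : Array (Array ℤ) → List (ℕ × ℤ) → ℤ → List (ℕ × ℤ) → Array (Array ℤ)
  | A, _, _, [] => A
  | A, vS, x, pa :: uS => addTerm (addRow A pa.1 (x * pa.2) vS) vS x uS

/-- Semantics of `addTerm`. [this work] -/
theorem entry2_addTerm : ∀ (A : Array (Array ℤ)) (vS : List (ℕ × ℤ)) (x : ℤ) (uS : List (ℕ × ℤ)) (i j : ℕ),
    entry2 (addTerm A vS x uS) i j = (entry2 A i j).map (· + x * evalSparse uS i * evalSparse vS j)
  | A, vS, x, [], i, j => by rw [addTerm]; cases entry2 A i j <;> simp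
  | A, vS, x, pa :: uS, i, j => by
    rw [addTerm, entry2_addTerm, entry2_addRow, evalSparse_cons]
    cases entry2 A i j <;> simp only [Option.map_none, Option.map_some]
    split_ifs <;> simp_all; ring

/-- A sparse rank-one term `(u, v, x)`. [this work] -/
abbrev STerm := List (ℕ × ℤ) × List (ℕ × ℤ) × ℤ

/-- Accumulate `Σ x · u ⊗ v` over a list of sparse rank-one terms. [this work] -/
def accGH : Array (Array ℤ) → List STerm → Array (Array ℤ)
  | A, [] => A
  | A, t :: T => accGH (addTerm A t.2.1 t.2.2 t.1) T

/-- The entry `(i, j)` of `Σ x · u ⊗ v` computed termwise. [this work] -/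
def ghEval : List STerm → ℕ → ℕ → ℤ
  | [], _, _ => 0
  | t :: T, i, j => t.2.2 * evalSparse t.1 i * evalSparse t.2.1 j + ghEval T i j

/-- ★ Semantics of `accGH`. [this work] -/
theorem entry2_accGH : ∀ (A : Array (Array ℤ)) (T : List STerm) (i j : ℕ),
    entry2 (accGH A T) i j = (entry2 A i j).map (· + ghEval T i j)
  | A, [], i, j => by rw [accGH]; cases entry2 A i j <;> simp [ghEval]
  | A, t :: T, i, j => by
    rw [accGH, entry2_accGH, entry2_addTerm, ghEval]
    cases entry2 A i j <;> simp only [Option.map_none, Option.map_some]; ring_nf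

/-- The zero matrix has entry `0` in range. [this work] -/
theorem entry2_replicate {N i j : ℕ} (hi : i < N) (hj : j < N) :
    entry2 (Array.replicate N (Array.replicate N (0 : ℤ))) i j = some 0 := by
  unfold entry2
  rw [Array.getElem?_replicate, if_pos hi, Option.bind_some, Array.getElem?_replicate, if_pos hj]

end Summit.CriticalPhenomena.PercolationContinuityZ3.Theorems.SahiThreeCopy
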